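import Summits.BirchSwinnertonDyer.Rank1Residual.GaloisImage.KuriharaRecordBSDpThreeLevelOneEndLargeLevel
import Summits.BirchSwinnertonDyer.Rank1Residual.GaloisImage.KuriharaRecordBSDpThreeLevelTwoEndNoEP
import HarnessLib

/-!
# END-m1 record corollaries at LARGE LEVEL (`N > 130000`, Manin binder per pair) WITHOUT the `hEP`
# binder: Tate's local Euler–Poincaré characteristic formula is a THEOREM of the tree (cell `b2b-bsdres`,
# team n1011, seat p03 GEN 9, OWNERS row T-R1-57-REC record-side tool; lead R5-75 (b)(i) consumer rule +
# R5-75 (d) 'appends to `…LevelOneEndLargeLevel.lean` = p03 lineage'; twins of p03's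
# `GaloisImage/KuriharaRecordBSDpThreeLevelOneEndLargeLevel.lean` (p300043 ≡ p300046) fed by n1011-p04's
# `GaloisImage/EPCTateFormula.lean` (p300886) through n1011-p18's by-name discharge
# `Assembly.localEulerPoincareCharacteristic_rat` (`GaloisImage/KuriharaRecordBSDpThreeLevelTwoEndNoEP.lean`))

HONEST FRAMING (cell `b2b-bsdres`, run/shared/lean/b2b/bsd-rank1-residual/, verbatim in every
file): the goal of the cell is to DELETE the COMBINATION-SHAPED residual classes of the
Birch–Swinnerton-Dyer formula for ALL analytic-rank `≤ 1` elliptic curves over `ℚ` — "full BSD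
formula for every rank `≤ 1` curve in class `C`" assembled STRICTLY from published theorems — so
that the rank-`≤ 1` remainder becomes exactly the CONSTRUCTION-SHAPED classes, which are TYPED
(missing-input `Prop`s), NOT attempted. This is not "finishing BSD". Team n1011 (N10/N11, the
additive block `X4 ∧ p = 3`): research route; PER-PAIR record SHAPE, NOT a class theorem; TOOL
theorems only (no definition, no named fact); nothing booked; no mark / label moved; the shapes
below CLOSE NOTHING.  END-m1 is DEBT REDUCTION, not coverage.

## What and why

Every END-m1 record corollary of the Kurihara lane carries the binder
`hEP : ∀ v : HeightOneSpectrum (𝓞 ℚ), localEulerPoincareCharacteristic (v.adicCompletion ℚ)` — Tate's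
local Euler–Poincaré characteristic formula (Milne, *ADT* I Thm. 2.8; Serre, *CG* II §5.7 Thm. 5) at
every finite place of `ℚ`, consumed on the LOWER side by the Selmer-structure bookkeeping behind
`exists_ne_zero_mem_selmerGroup_three_of_port_of_kolyvaginProduct_of_baseRigidity`.  Since n1011-p04's
`EPCTate.localEulerPoincareCharacteristic (F)` (p300886, `GaloisImage/EPCTateFormula.lean`) the named
fact's statement is a THEOREM for every non-archimedean local field of characteristic `0`, in
particular for each `v.adicCompletion ℚ`.  Per the n1011 lead's consumer rule (R5-75 (b)(i): "every
n1011 file that carries `(hEP : localEulerPoincareCharacteristic K)` MAY discharge it by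
`EPCTate.localEulerPoincareCharacteristic K` … by the consumer's OWN append, one theorem per END")
this file states the three `hEP`-carrying ENDs of p03's LARGE-LEVEL file — the (M)-row pair
`bsdp_three_potMult_of_levelOneCertificates_of_{baseRigidity,facts}_of_maninUnit` and the potentially GOOD
tower form `bsdp_three_of_towerSurj_of_levelOneCertificates_of_baseRigidity_of_maninUnit` (Manin input as the
per-pair binder `hcD : ¬ (3 : ℤ) ∣ D.maninConstant`, EVIDENCE on a record; the two sockets and the
level-zero witness of that file carry no `hEP` and get no twin) — WITHOUT `hEP` (suffix `_noEP`, the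
cell's convention — p16 p301705, p18's `…LevelTwoEndNoEP`; every other binder unchanged and in the same
order) and proves each by feeding
`hEP := localEulerPoincareCharacteristic_rat` (n1011-p18's packaging of
`fun v => EPCTate.localEulerPoincareCharacteristic (v.adicCompletion ℚ)` with the `CharZero (v.adicCompletion ℚ)`
instance supplied — the tree's `Prop` does not carry `[CharZero F]`, p04's theorem does) to the
`_of_maninUnit` theorem — a hypothesis DISCHARGED BY A THEOREM, not relabelled; ONE road for the discharge
term (p18's, by name).  A sibling file `<File>EPC.lean` rather than an append: the 400-line cap (lead
R5-75 ADD 3).  Binder diff against p300043 = {`hEP`} exactly (`hr` stays: the lead's twin rule; it is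
read off `hunit₁` by `analyticRank_eq_zero_of_kuriharaNumber_one_ne_zero` in any record that wants it).
Effect on a future large-level END-m1 record (the 3 383 class-A1 UNIT rows with `N > 130000`,
`b2b-bsdres-n1011-p03/g7/scale/ENDM1-SCALE-levels.tsv`): the pass-through binder `hEP` disappears; the
Manin line stays the per-pair EVIDENCE binder `hcD`.  Nothing else changes; nothing is booked; no class
closes.

References: J. S. Milne, *Arithmetic Duality Theorems* (2006) I §2 Thm. 2.8 [MilneADT2006];
J.-P. Serre, *Galois Cohomology* (1997) II §5.7 Thm. 5 [SerreGaloisCohomology1997];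
C.-H. Kim, AJM 148 (2026) §1.4.3, Thm. 1.9 (6), Thm. 3.13 [Kim2022StructureSelmer];
B. Mazur, J. Tate, J. Teitelbaum, Invent. Math. 84 (1986) §I.8 (8.6) [MazurTateTeitelbaum1986Invent];
K. Rubin, PCMI 18 (2011) Thm. 2.8.4 [Rubin2011]; K. Kato, Astérisque 295 (2004) Thm. 14.5 (3)
[Kato2004Asterisque]; D. Delbourgo (1998) Prop. 4 [Delbourgo1998]; Agashe–Ribet–Stein (2006) §2
[AgasheRibetStein2006]; J. E. Cremona, *Algorithms for Modular Elliptic Curves* (1997) §2.9–2.11 +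
`ecdata` `opt_man` [CremonaAlgorithms1997]; J. H. Silverman, AEC (2009) X.4.14 [SilvermanAEC2009];
cell files cells/n1011/PLAN.md R5-75 (b)/(d), OWNERS.md (T-R1-57-REC, T-EPC).
-/

noncomputable section

open scoped Classical NumberField ContRepresentation
open Function Field NumberField IsDedekindDomain IsDedekindDomain.HeightOneSpectrum WeierstrassCurve
  CongruenceSubgroup
  Literature.NumberTheory.EllipticCurves Literature.NumberTheory.EllipticCurves.ModularForms
  Literature.NumberTheory.EllipticCurves.Rank1Residual
  Literature.NumberTheory.EllipticCurves.AgasheRibetStein2006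
  Literature.NumberTheory.GaloisRepresentations
  Literature.NumberTheory.GaloisRepresentations.DiscreteGaloisModule Literature.NumberTheory.GaloisCohomology
  Rat.HeightOneSpectrum
  Summit.BirchSwinnertonDyer.Rank1Residual.Additive Summit.BirchSwinnertonDyer.Rank1Residual.X4

namespace Summit.BirchSwinnertonDyer.Rank1Residual.GaloisImage.Assembly

/-- **END-m1 RECORD COROLLARY, (M) rows, [S24]-FREE, at LARGE LEVEL (Manin binder per pair), no `hEP`.**
Exactly p03's `bsdp_three_potMult_of_levelOneCertificates_of_baseRigidity_of_maninUnit` with the binder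
`hEP : ∀ v, localEulerPoincareCharacteristic (v.adicCompletion ℚ)` DELETED — hEP discharged by p300886
(`EPCTate.localEulerPoincareCharacteristic`, Tate's local Euler–Poincaré characteristic formula, a theorem
of the tree, fed by name as p18's `localEulerPoincareCharacteristic_rat`); all other binders unchanged and
in the same order.  CLOSES NOTHING; the Kurihara values and `hcD` stay EVIDENCE hypotheses; nothing booked.
[cite: MilneADT2006, I §2 Thm 2.8 (p. 31)] [cite: Kim2022StructureSelmer, Thm. 1.9 (6) and Thm. 3.13]
[cite: Rubin2011, Thm. 2.8.4] [cite: Delbourgo1998, Prop. 4 (p. 144)] [cite: AgasheRibetStein2006, §2]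
[cite: SilvermanAEC2009, Thm. X.4.14] -/
theorem bsdp_three_potMult_of_levelOneCertificates_of_baseRigidity_of_maninUnit_noEP
    (hKatoS : Kato2004.rankZero_padicValNat_sha_le_sub_localTamagawa_of_additive_potGood_of_imageContainsSL2)
    (hDel : Delbourgo1998.prop4_rankZero_pow_dvd_constantCoeff)
    (hGZK : rank_eq_analyticRank_of_analyticRank_le_one) (hmod : hasEntireLFunction_rat)
    (hmodD : nonempty_modularParametrizationData)
    (hKatoχ : Wuthrich2014.kato_halfEigenCharIdeal_dvd_cyclotomicPrime_of_surjective)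
    (hCT : exists_casselsTate_pairing (K := ℚ))
    (W : WeierstrassCurve ℚ) [W.IsElliptic] [W.IsGloballyMinimal]
    {E₀ : WeierstrassCurve ℤ} (hI : integralModelInt W = E₀)
    (hΔ : (3 : ℤ) ∣ E₀.Δ) (hc₄ : (3 : ℤ) ∣ E₀.c₄)
    (hsurj : W.HasSurjectiveModNGaloisRep ((3 : ℕ) : ℤ)) (hjneg : padicValRat 3 W.j < 0)
    (hc3 : ¬ 3 ∣ (W.baseChange ℚ_[3]).localTamagawaNumber ℤ_[3])
    (ht0 : Nat.card {Q : (W.baseChange ℚ_[3]).toAffine.Point // (3 : ℕ) • Q = 0} = 1)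
    (hr : W.analyticRank = 0)
    {N : ℕ} [NeZero N] (D : ModularParametrizationData W N)
    (hopt : ∀ z ∈ D.L.lattice, ∃ w ∈ periodLattice D.f, z = D.c * w)
    (hcD : ¬ (3 : ℤ) ∣ D.maninConstant)
    (inv : LocalInvariants ℚ 3) (hperf : inv.IsPerfect) (hsum : inv.SumLocalTermEqZero)
    (hcompl : inv.SelmerComplement)
    (v₃ : HeightOneSpectrum (𝓞 ℚ)) (hv₃ : ((3 : ℕ) : 𝓞 ℚ) ∈ v₃.asIdeal)
    (hPort : KatoKuriharaPortThreeAt W 0 v₃)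
    (n : ℕ) [NeZero n] (hn : Kato.IsKolyvaginProduct W 3 1 n)
    (hcyc : ∀ (ℓ : ℕ) [Fact ℓ.Prime], ℓ ∣ n →
      Nat.card {P : ((integralModelInt W).map (Int.castRingHom (ZMod ℓ))).toAffine.Point //
        3 • P = 0} ≤ 3)
    (ψ : (ℓ : ℕ) → (ZMod ℓ)ˣ →* Multiplicative (ZMod (3 ^ 1)))
    (hψ : ∀ ℓ ∈ n.primeFactors, Function.Surjective (ψ ℓ))
    (hcert : kuriharaNumber D.f (3 ^ 1) n ψ ≠ 0)
    (hzero₁ : kuriharaNumber D.f (3 ^ 1) 1 ψ = 0)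
    (ψ₂₇ : (ℓ : ℕ) → (ZMod ℓ)ˣ →* Multiplicative (ZMod (3 ^ 3)))
    (hunit₁ : kuriharaNumber D.f (3 ^ 3) 1 ψ₂₇ ≠ 0) :
    BSDp W 3 :=
  bsdp_three_potMult_of_levelOneCertificates_of_baseRigidity_of_maninUnit hKatoS hDel hGZK hmod hmodD hKatoχ
    hCT W hI hΔ hc₄ hsurj hjneg hc3 ht0 hr D hopt hcD inv hperf hsum hcompl
    localEulerPoincareCharacteristic_rat v₃ hv₃ hPort n hn hcyc ψ hψ hcert hzero₁ ψ₂₇ hunit₁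

/-- **END-m1 RECORD COROLLARY, (M) rows, NAMED-FACTS form, at LARGE LEVEL (Manin binder per pair), no
`hEP`.**  Exactly p03's `bsdp_three_potMult_of_levelOneCertificates_of_facts_of_maninUnit` (PT family as the
named fact `hPT : poitouTate_selmerStructure_duality ℚ`) with the binder `hEP` DELETED — hEP discharged by
p300886 (`EPCTate.localEulerPoincareCharacteristic`, fed by name as `localEulerPoincareCharacteristic_rat`);
all other binders unchanged and in the same order.  CLOSES NOTHING; nothing booked.
[cite: MilneADT2006, I §2 Thm 2.8 (p. 31)] [cite: Kim2022StructureSelmer, Thm. 1.9 (6) and Thm. 3.13]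
[cite: Rubin2011, Thm. 2.8.4] [cite: Delbourgo1998, Prop. 4 (p. 144)] [cite: AgasheRibetStein2006, §2] -/
theorem bsdp_three_potMult_of_levelOneCertificates_of_facts_of_maninUnit_noEP
    (hKatoS : Kato2004.rankZero_padicValNat_sha_le_sub_localTamagawa_of_additive_potGood_of_imageContainsSL2)
    (hDel : Delbourgo1998.prop4_rankZero_pow_dvd_constantCoeff)
    (hGZK : rank_eq_analyticRank_of_analyticRank_le_one) (hmod : hasEntireLFunction_rat)
    (hmodD : nonempty_modularParametrizationData)
    (hKatoχ : Wuthrich2014.kato_halfEigenCharIdeal_dvd_cyclotomicPrime_of_surjective)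
    (hCT : exists_casselsTate_pairing (K := ℚ))
    (W : WeierstrassCurve ℚ) [W.IsElliptic] [W.IsGloballyMinimal]
    {E₀ : WeierstrassCurve ℤ} (hI : integralModelInt W = E₀)
    (hΔ : (3 : ℤ) ∣ E₀.Δ) (hc₄ : (3 : ℤ) ∣ E₀.c₄)
    (hsurj : W.HasSurjectiveModNGaloisRep ((3 : ℕ) : ℤ)) (hjneg : padicValRat 3 W.j < 0)
    (hc3 : ¬ 3 ∣ (W.baseChange ℚ_[3]).localTamagawaNumber ℤ_[3])
    (ht0 : Nat.card {Q : (W.baseChange ℚ_[3]).toAffine.Point // (3 : ℕ) • Q = 0} = 1)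
    (hr : W.analyticRank = 0)
    {N : ℕ} [NeZero N] (D : ModularParametrizationData W N)
    (hopt : ∀ z ∈ D.L.lattice, ∃ w ∈ periodLattice D.f, z = D.c * w)
    (hcD : ¬ (3 : ℤ) ∣ D.maninConstant)
    (hPT : poitouTate_selmerStructure_duality ℚ)
    (v₃ : HeightOneSpectrum (𝓞 ℚ)) (hv₃ : ((3 : ℕ) : 𝓞 ℚ) ∈ v₃.asIdeal)
    (hPort : KatoKuriharaPortThreeAt W 0 v₃)
    (n : ℕ) [NeZero n] (hn : Kato.IsKolyvaginProduct W 3 1 n)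
    (hcyc : ∀ (ℓ : ℕ) [Fact ℓ.Prime], ℓ ∣ n →
      Nat.card {P : ((integralModelInt W).map (Int.castRingHom (ZMod ℓ))).toAffine.Point //
        3 • P = 0} ≤ 3)
    (ψ : (ℓ : ℕ) → (ZMod ℓ)ˣ →* Multiplicative (ZMod (3 ^ 1)))
    (hψ : ∀ ℓ ∈ n.primeFactors, Function.Surjective (ψ ℓ))
    (hcert : kuriharaNumber D.f (3 ^ 1) n ψ ≠ 0)
    (hzero₁ : kuriharaNumber D.f (3 ^ 1) 1 ψ = 0)
    (ψ₂₇ : (ℓ : ℕ) → (ZMod ℓ)ˣ →* Multiplicative (ZMod (3 ^ 3)))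
    (hunit₁ : kuriharaNumber D.f (3 ^ 3) 1 ψ₂₇ ≠ 0) :
    BSDp W 3 :=
  bsdp_three_potMult_of_levelOneCertificates_of_facts_of_maninUnit hKatoS hDel hGZK hmod hmodD hKatoχ hCT W
    hI hΔ hc₄ hsurj hjneg hc3 ht0 hr D hopt hcD hPT localEulerPoincareCharacteristic_rat v₃ hv₃ hPort n hn
    hcyc ψ hψ hcert hzero₁ ψ₂₇ hunit₁

/-- **END-m1 RECORD COROLLARY, potentially GOOD rows (tower form), [S24]-FREE, at LARGE LEVEL (Manin
binder per pair), no `hEP`.**  Exactly p03's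
`bsdp_three_of_towerSurj_of_levelOneCertificates_of_baseRigidity_of_maninUnit` with the binder `hEP` DELETED —
hEP discharged by p300886 (`EPCTate.localEulerPoincareCharacteristic`, fed by name as
`localEulerPoincareCharacteristic_rat`); all other binders unchanged and in the same order.  CLOSES NOTHING;
the Kurihara values and `hcD` stay EVIDENCE hypotheses; nothing booked.
[cite: MilneADT2006, I §2 Thm 2.8 (p. 31)] [cite: Kim2022StructureSelmer, Thm. 1.9 (6) and Thm. 3.13]
[cite: Rubin2011, Thm. 2.8.4] [cite: Kato2004Asterisque, Thm. 14.5 (3) (p. 236)] [cite: AgasheRibetStein2006, §2]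
[cite: SilvermanAEC2009, Thm. X.4.14] -/
theorem bsdp_three_of_towerSurj_of_levelOneCertificates_of_baseRigidity_of_maninUnit_noEP
    (hKatoS : Kato2004.rankZero_padicValNat_sha_le_sub_localTamagawa_of_additive_potGood_of_imageContainsSL2)
    (hDel : Delbourgo1998.prop4_rankZero_pow_dvd_constantCoeff)
    (hGZK : rank_eq_analyticRank_of_analyticRank_le_one) (hmod : hasEntireLFunction_rat)
    (hmodD : nonempty_modularParametrizationData)
    (hKatoχ : Wuthrich2014.kato_halfEigenCharIdeal_dvd_cyclotomicPrime_of_surjective)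
    (hCT : exists_casselsTate_pairing (K := ℚ))
    (W : WeierstrassCurve ℚ) [W.IsElliptic] [W.IsGloballyMinimal]
    {E₀ : WeierstrassCurve ℤ} (hI : integralModelInt W = E₀)
    (hΔ : (3 : ℤ) ∣ E₀.Δ) (hc₄ : (3 : ℤ) ∣ E₀.c₄)
    (htower : ∀ m : ℕ, W.HasSurjectiveModNGaloisRep (3 ^ m : ℕ))
    (ht0 : Nat.card {Q : (W.baseChange ℚ_[3]).toAffine.Point // (3 : ℕ) • Q = 0} = 1)
    (hr : W.analyticRank = 0) (htam : ¬ 3 ∣ W.tamagawaProduct)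
    {N : ℕ} [NeZero N] (D : ModularParametrizationData W N)
    (hopt : ∀ z ∈ D.L.lattice, ∃ w ∈ periodLattice D.f, z = D.c * w)
    (hcD : ¬ (3 : ℤ) ∣ D.maninConstant)
    (inv : LocalInvariants ℚ 3) (hperf : inv.IsPerfect) (hsum : inv.SumLocalTermEqZero)
    (hcompl : inv.SelmerComplement)
    (v₃ : HeightOneSpectrum (𝓞 ℚ)) (hv₃ : ((3 : ℕ) : 𝓞 ℚ) ∈ v₃.asIdeal)
    (hPort : KatoKuriharaPortThreeAt W 0 v₃)
    (n : ℕ) [NeZero n] (hn : Kato.IsKolyvaginProduct W 3 1 n)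
    (hcyc : ∀ (ℓ : ℕ) [Fact ℓ.Prime], ℓ ∣ n →
      Nat.card {P : ((integralModelInt W).map (Int.castRingHom (ZMod ℓ))).toAffine.Point //
        3 • P = 0} ≤ 3)
    (ψ : (ℓ : ℕ) → (ZMod ℓ)ˣ →* Multiplicative (ZMod (3 ^ 1)))
    (hψ : ∀ ℓ ∈ n.primeFactors, Function.Surjective (ψ ℓ))
    (hcert : kuriharaNumber D.f (3 ^ 1) n ψ ≠ 0)
    (hzero₁ : kuriharaNumber D.f (3 ^ 1) 1 ψ = 0)
    (ψ₂₇ : (ℓ : ℕ) → (ZMod ℓ)ˣ →* Multiplicative (ZMod (3 ^ 3)))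
    (hunit₁ : kuriharaNumber D.f (3 ^ 3) 1 ψ₂₇ ≠ 0) :
    BSDp W 3 :=
  bsdp_three_of_towerSurj_of_levelOneCertificates_of_baseRigidity_of_maninUnit hKatoS hDel hGZK hmod hmodD
    hKatoχ hCT W hI hΔ hc₄ htower ht0 hr htam D hopt hcD inv hperf hsum hcompl
    localEulerPoincareCharacteristic_rat v₃ hv₃ hPort n hn hcyc ψ hψ hcert hzero₁ ψ₂₇ hunit₁

end Summit.BirchSwinnertonDyer.Rank1Residual.GaloisImage.Assembly

end
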